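import Summits.AtomisticToContinuum.Crystallization.Theses.PricedLinkCensus
import Summits.AtomisticToContinuum.Crystallization.Theorems.PricedLinkCensusSoftLayerPropagationBasics

/-!
# `SoftLayerPropagation` from three pieces: shadow stacking map, real ball, tracking licence

Crux `PricedLinkCensus.SoftLayerPropagation` (stmt-AtomisticToContinuum-14233), crux-strategist s2
(2026-08-17): the ROUTE-LEVEL decomposition glue.  The three hypotheses are exactly the open fronts of
the live line `Sketch` v7 (lead c3), stated as self-contained propositions over Literature declarations:

1. `ShadowStackingMap` — COMBINATORIAL (η = 0 in substance; charts + the landed exact development + the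
   map-based finite-ball engine): from charge-freeness on the `8·nn_i`-ball, an exact development `D` of the
   graph `5`-ball (every star carried exactly onto a rotated FCC/HCP pattern, bonds = unit shadow distances,
   `nn_j/4` local closeness) together with ONE Hägg sequence `s` and rigid motion `φ` of shadow space with
   membership, surjectivity and injectivity at shadow radius `33/10`;
2. `RealBallInShadow` — the real `3·nn_i`-ball lies in the graph `5`-ball with shadow within `33/10`
   (= `Sketch.stub_realBall` verbatim);
3. `TrackingLicence` — ONE rigid motion tracks the developed sites of the shadow `33/10`-ball to `nn_i/6`
   (= `Sketch.stub_licence` verbatim; the sharp metric statement, certified-numerics class).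

`SoftLayerPropagation_of_pieces : ShadowStackingMap → RealBallInShadow → TrackingLicence →
SoftLayerPropagation` is the v7 composition with the stubs replaced by hypotheses (glue: `nn_i > 0` at a
charge-free site, scaling of Barlow stackings, the two-way matching).  No new definitions: the three
pieces are written out as the hypothesis types.
-/

noncomputable section

namespace Summit.AtomisticToContinuum.Crystallization.Theorems

open Literature.Geometry.DiscreteGeometry Literature.MathematicalPhysics.StatisticalMechanics

/-- **Radius bookkeeping of clause 2** (registered helper `licence_centre_radius`): if the centre `p` is
`a/6`-close to `g (a • c)` and `g (a • x)` is within `3a` of `p`, then `dist x c ≤ 19/6`. -/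
theorem licence_centre_radius : ∀ a : ℝ, 0 < a → ∀ (g : EuclideanSpace ℝ (Fin 3) ≃ᵃⁱ[ℝ] EuclideanSpace ℝ (Fin 3)) (p x c : EuclideanSpace ℝ (Fin 3)), dist p (g (a • c)) ≤ a / 6 → dist p (g (a • x)) ≤ 3 * a → dist x c ≤ 19 / 6 := by
  intro a ha g p x c hc hx
  have hdist : dist (a • x) (a • c) = a * dist x c := by
    rw [dist_smul₀, Real.norm_eq_abs, abs_of_pos ha]
  have h1 : dist (g (a • x)) (g (a • c)) ≤ dist (g (a • x)) p + dist p (g (a • c)) := dist_triangle _ _ _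
  rw [AffineIsometryEquiv.dist_map, hdist, dist_comm (g (a • x)) p] at h1
  have h3 : a * dist x c ≤ a * (19 / 6) := by linarith
  exact le_of_mul_le_mul_left h3 ha

/-- **The crux from its three pieces** (`ShadowStackingMap → RealBallInShadow → TrackingLicence →
SoftLayerPropagation`).  Proof = the composition of line `Sketch` v7 with its stubs as hypotheses: the
centre is charge-free hence has positive scale; take `D, φ, s` from the first piece; the real `3·nn_i`-ball
is developed with shadow `≤ 33/10` (second piece); one rigid motion `g` tracks the developed shadow ball to
`nn_i/6` (third piece); clause 1 of the crux by membership + scaling `barlowStacking a (a√(2/3)) s =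
a • barlowStacking 1 √(2/3) s`; clause 2 by surjectivity: a stacking point within `3·nn_i` of `y i` is,
after unscaling, within `19/6 ≤ 33/10` of `φ (D i)` because the centre itself is tracked. -/
theorem SoftLayerPropagation_of_pieces : (∀ η : ℝ, 0 < η → η ≤ 1 / 100 → ∀ (N : ℕ) (y : Fin N → EuclideanSpace ℝ (Fin 3)) (i : Fin N), 0 < Literature.Geometry.DiscreteGeometry.nearestDist y i → (∀ j : Fin N, dist (y i) (y j) ≤ 8 * Literature.Geometry.DiscreteGeometry.nearestDist y i → Literature.Geometry.DiscreteGeometry.IsChargeFree η y j) → ∃ (D : Fin N → EuclideanSpace ℝ (Fin 3)) (φ : EuclideanSpace ℝ (Fin 3) ≃ᵃⁱ[ℝ] EuclideanSpace ℝ (Fin 3)) (s : ℤ → ℤ), (∀ j : Fin N, (∃ w : (Literature.Geometry.DiscreteGeometry.bondGraph η y).Walk i j, w.length ≤ 5) → ∃ (P : Finset (EuclideanSpace ℝ (Fin 3))) (Q R : EuclideanSpace ℝ (Fin 3) →ₗᵢ[ℝ] EuclideanSpace ℝ (Fin 3)), (P = Literature.Geometry.DiscreteGeometry.fccKissingPattern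 ∨ P = Literature.Geometry.DiscreteGeometry.hcpKissingPattern) ∧ D '' {k | (Literature.Geometry.DiscreteGeometry.bondGraph η y).Adj j k} = (fun p => D j + Q p) '' (P : Set (EuclideanSpace ℝ (Fin 3))) ∧ (∀ k, (Literature.Geometry.DiscreteGeometry.bondGraph η y).Adj j k → ‖(y k - y j) - Literature.Geometry.DiscreteGeometry.nearestDist y j • R (D k - D j)‖ ≤ Literature.Geometry.DiscreteGeometry.nearestDist y j / 4) ∧ (∀ k k', (Literature.Geometry.DiscreteGeometry.bondGraph η y).Adj j k → (Literature.Geometry.DiscreteGeometry.bondGraph η y).Adj j k' → ((Literature.Geometry.DiscreteGeometry.bondGraph η y).Adj k k' ↔ dist (D k) (D k') = 1))) ∧ Literature.MathematicalPhysics.StatisticalMechanics.IsHaggSeq s ∧ (∀ j : Fin N, (∃ w : (Literature.Geometry.DiscreteGeometry.bondGraph η y).Walk i j, w.length ≤ 5) → dist (D j) (D i) ≤ 33 / 10 → φ (D j) ∈ Literature.MathematicalPhysics.StatisticalMechanics.barlowStacking 1 (Real.sqrt (2 / 3)) s) ∧ (∀ z ∈ Literature.MathematicalPhysics.StatisticalMechanics.barlowStacking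 1 (Real.sqrt (2 / 3)) s, dist z (φ (D i)) ≤ 33 / 10 → ∃ j : Fin N, (∃ w : (Literature.Geometry.DiscreteGeometry.bondGraph η y).Walk i j, w.length ≤ 5) ∧ dist (D j) (D i) ≤ 33 / 10 ∧ φ (D j) = z) ∧ (∀ j k : Fin N, (∃ w : (Literature.Geometry.DiscreteGeometry.bondGraph η y).Walk i j, w.length ≤ 5) → (∃ w : (Literature.Geometry.DiscreteGeometry.bondGraph η y).Walk i k, w.length ≤ 5) → dist (D j) (D i) ≤ 33 / 10 → dist (D k) (D i) ≤ 33 / 10 → D j = D k → j = k)) → (∀ η : ℝ, 0 < η → η ≤ 1 / 100 → ∀ (N : ℕ) (y : Fin N → EuclideanSpace ℝ (Fin 3)) (i : Fin N), 0 < Literature.Geometry.DiscreteGeometry.nearestDist y i → (∀ j : Fin N, dist (y i) (y j) ≤ 8 * Literature.Geometry.DiscreteGeometry.nearestDist y i → Literature.Geometry.DiscreteGeometry.IsChargeFree η y j) → ∀ (D : Fin N → EuclideanSpace ℝ (Fin 3)) (φ : EuclideanSpace ℝ (Fin 3) ≃ᵃⁱ[ℝ] EuclideanSpace ℝ (Fin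 3)) (s : ℤ → ℤ), (∀ j : Fin N, (∃ w : (Literature.Geometry.DiscreteGeometry.bondGraph η y).Walk i j, w.length ≤ 5) → ∃ (P : Finset (EuclideanSpace ℝ (Fin 3))) (Q R : EuclideanSpace ℝ (Fin 3) →ₗᵢ[ℝ] EuclideanSpace ℝ (Fin 3)), (P = Literature.Geometry.DiscreteGeometry.fccKissingPattern ∨ P = Literature.Geometry.DiscreteGeometry.hcpKissingPattern) ∧ D '' {k | (Literature.Geometry.DiscreteGeometry.bondGraph η y).Adj j k} = (fun p => D j + Q p) '' (P : Set (EuclideanSpace ℝ (Fin 3))) ∧ (∀ k, (Literature.Geometry.DiscreteGeometry.bondGraph η y).Adj j k → ‖(y k - y j) - Literature.Geometry.DiscreteGeometry.nearestDist y j • R (D k - D j)‖ ≤ Literature.Geometry.DiscreteGeometry.nearestDist y j / 4) ∧ (∀ k k', (Literature.Geometry.DiscreteGeometry.bondGraph η y).Adj j k → (Literature.Geometry.DiscreteGeometry.bondGraph η y).Adj j k' → ((Literature.Geometry.DiscreteGeometry.bondGraph η y).Adj k k' ↔ dist (D k) (D k') = 1))) → Literature.MathematicalPhysics.StatisticalMechanics.IsHaggSeq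 s → (∀ j : Fin N, (∃ w : (Literature.Geometry.DiscreteGeometry.bondGraph η y).Walk i j, w.length ≤ 5) → dist (D j) (D i) ≤ 33 / 10 → φ (D j) ∈ Literature.MathematicalPhysics.StatisticalMechanics.barlowStacking 1 (Real.sqrt (2 / 3)) s) → (∀ z ∈ Literature.MathematicalPhysics.StatisticalMechanics.barlowStacking 1 (Real.sqrt (2 / 3)) s, dist z (φ (D i)) ≤ 33 / 10 → ∃ j : Fin N, (∃ w : (Literature.Geometry.DiscreteGeometry.bondGraph η y).Walk i j, w.length ≤ 5) ∧ dist (D j) (D i) ≤ 33 / 10 ∧ φ (D j) = z) → (∀ j k : Fin N, (∃ w : (Literature.Geometry.DiscreteGeometry.bondGraph η y).Walk i j, w.length ≤ 5) → (∃ w : (Literature.Geometry.DiscreteGeometry.bondGraph η y).Walk i k, w.length ≤ 5) → dist (D j) (D i) ≤ 33 / 10 → dist (D k) (D i) ≤ 33 / 10 → D j = D k → j = k) → ∀ j : Fin N, dist (y i) (y j) ≤ 3 * Literature.Geometry.DiscreteGeometry.nearestDist y i → (∃ w : (Literature.Geometry.DiscreteGeometry.bondGraph η y).Walk i j, w.length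 ≤ 5) ∧ dist (D j) (D i) ≤ 33 / 10) → (∀ η : ℝ, 0 < η → η ≤ 1 / 100 → ∀ (N : ℕ) (y : Fin N → EuclideanSpace ℝ (Fin 3)) (i : Fin N), 0 < Literature.Geometry.DiscreteGeometry.nearestDist y i → (∀ j : Fin N, dist (y i) (y j) ≤ 8 * Literature.Geometry.DiscreteGeometry.nearestDist y i → Literature.Geometry.DiscreteGeometry.IsChargeFree η y j) → ∀ (D : Fin N → EuclideanSpace ℝ (Fin 3)) (φ : EuclideanSpace ℝ (Fin 3) ≃ᵃⁱ[ℝ] EuclideanSpace ℝ (Fin 3)) (s : ℤ → ℤ), (∀ j : Fin N, (∃ w : (Literature.Geometry.DiscreteGeometry.bondGraph η y).Walk i j, w.length ≤ 5) → ∃ (P : Finset (EuclideanSpace ℝ (Fin 3))) (Q R : EuclideanSpace ℝ (Fin 3) →ₗᵢ[ℝ] EuclideanSpace ℝ (Fin 3)), (P = Literature.Geometry.DiscreteGeometry.fccKissingPattern ∨ P = Literature.Geometry.DiscreteGeometry.hcpKissingPattern) ∧ D '' {k | (Literature.Geometry.DiscreteGeometry.bondGraph η y).Adj j k} = (fun p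 => D j + Q p) '' (P : Set (EuclideanSpace ℝ (Fin 3))) ∧ (∀ k, (Literature.Geometry.DiscreteGeometry.bondGraph η y).Adj j k → ‖(y k - y j) - Literature.Geometry.DiscreteGeometry.nearestDist y j • R (D k - D j)‖ ≤ Literature.Geometry.DiscreteGeometry.nearestDist y j / 4) ∧ (∀ k k', (Literature.Geometry.DiscreteGeometry.bondGraph η y).Adj j k → (Literature.Geometry.DiscreteGeometry.bondGraph η y).Adj j k' → ((Literature.Geometry.DiscreteGeometry.bondGraph η y).Adj k k' ↔ dist (D k) (D k') = 1))) → Literature.MathematicalPhysics.StatisticalMechanics.IsHaggSeq s → (∀ j : Fin N, (∃ w : (Literature.Geometry.DiscreteGeometry.bondGraph η y).Walk i j, w.length ≤ 5) → dist (D j) (D i) ≤ 33 / 10 → φ (D j) ∈ Literature.MathematicalPhysics.StatisticalMechanics.barlowStacking 1 (Real.sqrt (2 / 3)) s) → (∀ z ∈ Literature.MathematicalPhysics.StatisticalMechanics.barlowStacking 1 (Real.sqrt (2 / 3)) s, dist z (φ (D i)) ≤ 33 / 10 → ∃ j : Fin N, (∃ w : (Literature.Geometry.DiscreteGeometry.bondGraph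 η y).Walk i j, w.length ≤ 5) ∧ dist (D j) (D i) ≤ 33 / 10 ∧ φ (D j) = z) → (∀ j k : Fin N, (∃ w : (Literature.Geometry.DiscreteGeometry.bondGraph η y).Walk i j, w.length ≤ 5) → (∃ w : (Literature.Geometry.DiscreteGeometry.bondGraph η y).Walk i k, w.length ≤ 5) → dist (D j) (D i) ≤ 33 / 10 → dist (D k) (D i) ≤ 33 / 10 → D j = D k → j = k) → ∃ g : EuclideanSpace ℝ (Fin 3) ≃ᵃⁱ[ℝ] EuclideanSpace ℝ (Fin 3), ∀ j : Fin N, (∃ w : (Literature.Geometry.DiscreteGeometry.bondGraph η y).Walk i j, w.length ≤ 5) → dist (D j) (D i) ≤ 33 / 10 → dist (y j) (g (Literature.Geometry.DiscreteGeometry.nearestDist y i • φ (D j))) ≤ Literature.Geometry.DiscreteGeometry.nearestDist y i / 6) → Summit.AtomisticToContinuum.Crystallization.Theses.PricedLinkCensus.SoftLayerPropagation := by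
  intro hShadow hReal hLicence
  unfold Summit.AtomisticToContinuum.Crystallization.Theses.PricedLinkCensus.SoftLayerPropagation
  intro η hη hη1 N y i hcf
  have hpos : 0 < nearestDist y i := nearestDist_pos_of_ball_chargeFree hcf
  obtain ⟨D, φ, s, hD, hs, hmem, hsurj, hinj⟩ := hShadow η hη hη1 N y i hpos hcf
  have hreal := hReal η hη hη1 N y i hpos hcf D φ s hD hs hmem hsurj hinj
  obtain ⟨g, hg⟩ := hLicence η hη hη1 N y i hpos hcf D φ s hD hs hmem hsurj hinj
  refine ⟨s, g, hs, ?_, ?_⟩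
  · -- every site of the `3·nn_i`-ball is within `nn_i/6` of the rescaled shadow point
    intro j hj
    obtain ⟨hw, hd⟩ := hreal j hj
    exact ⟨nearestDist y i • φ (D j), smul_mem_barlowStacking (hmem j hw hd), hg j hw hd⟩
  · -- every stacking point of the `3·nn_i`-ball is within `nn_i/6` of a site
    intro z hz hzi
    obtain ⟨x, hx, rfl⟩ := exists_eq_smul_of_mem_barlowStacking hz
    have hwi : ∃ w : (bondGraph η y).Walk i i, w.length ≤ 5 := ⟨SimpleGraph.Walk.nil, by simp⟩
    have hdi : dist (D i) (D i) ≤ 33 / 10 := by rw [dist_self]; norm_num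
    have hgi := hg i hwi hdi
    have hx13 : dist x (φ (D i)) ≤ 33 / 10 := by
      have h4 := licence_centre_radius (nearestDist y i) hpos g (y i) x (φ (D i)) hgi hzi
      linarith
    obtain ⟨j, hw, hd, hjx⟩ := hsurj x hx hx13
    refine ⟨j, ?_⟩
    have := hg j hw hd
    rwa [hjx] at this

end Summit.AtomisticToContinuum.Crystallization.Theorems
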